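import Summits.MatrixMultiplication.MatrixMultiplication.Theorems.AbelianSTPPCensusTBStatDefs

/-!
# T_B static certificate, orders `2881 … 5000` (theory's t*-indexed linear checker at `τ = 2375/1000`): kernel evaluation, the domination checks, volumes `3500 … 3981`

Cell mm-stpp (rung F-M1), tier T_B = «beat `2.375` (Coppersmith–Winograd)»; checker in `AbelianSTPPCensusTBStatDefs.lean`, table in `AbelianSTPPCensusTBStatData.lean`
(pattern: theory g12's `AbelianSTPPCensusTAStatCDom*.lean`).  `decide` with kernel reduction (standard axioms; no `native_decide`), `Elab.async false`;
consumed by `TBStat.checkV_sound` / `TBStat.domV_sound` in the leaf `AbelianSTPPCensusLeafTB5000Closed.lean`.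
the domination checks, volumes `3500 … 3981` THIS IS NOT: arithmetic on shape lists only; no statement about STPP families or `ω`.
-/

set_option linter.dupNamespace false
set_option autoImplicit false
set_option Elab.async false

namespace Summit.MatrixMultiplication.MatrixMultiplication.Theorems.TBStat

set_option maxHeartbeats 0 in
/-- Domination chunk: every sorted candidate shape of the volumes `3500 … 3615` is dominated by the table (896 shapes). [original] -/
theorem dom3500 : TBStat.domV 116 3500 = true := by decide +kernel

set_option maxHeartbeats 0 in
/-- Domination chunk: every sorted candidate shape of the volumes `3616 … 3739` is dominated by the table (891 shapes). [original] -/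
theorem dom3616 : TBStat.domV 124 3616 = true := by decide +kernel

set_option maxHeartbeats 0 in
/-- Domination chunk: every sorted candidate shape of the volumes `3740 … 3860` is dominated by the table (892 shapes). [original] -/
theorem dom3740 : TBStat.domV 121 3740 = true := by decide +kernel

set_option maxHeartbeats 0 in
/-- Domination chunk: every sorted candidate shape of the volumes `3861 … 3981` is dominated by the table (898 shapes). [original] -/
theorem dom3861 : TBStat.domV 121 3861 = true := by decide +kernel

end Summit.MatrixMultiplication.MatrixMultiplication.Theorems.TBStat
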